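import Mathlib
import HarnessLib
import HarnessLib.Audit
import Summits.ValiantsHypothesis.ValiantsHypothesis.Theorems.LacunarySymmetroidMatrixDescartesZeroChangeRows

/-!
# ValiantsHypothesis / LacunarySymmetroid — crux `MatrixDescartes` (stmt-ValiantsHypothesis-18050, V1), LINE (A) «product_plus_one»:
# the `r = 1` STRUCTURE LEMMA of NOTE §56.8 (3) (pen val-idea-25 g9): the dip window of one W row + zero-change rows is an interval

NOTE §56.7/§56.8 (pen val-idea-25 g9): dips (local minima of `|Φ|` off the roots) of a company lie in `𝔅 = {M < 0 < T}`, `M`, `T` the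
middle- and top-letter Pick sums.  §56.8 (3), the `r = 1` STRUCTURE LEMMA (exact): for ONE W row `g_W = −α + κt^a + γt^c` and ANY
number of zero-change rows `P_i = p_i + q_it^a + s_it^c` (`p_i, s_i > 0 ≤ q_i, κ`), the part of `𝔅` left of the W root (where
`g_W < 0`) is ONE INTERVAL.  Typed here as `Set.OrdConnected` of
`{t > 0 ∣ g_W(t) < 0 ∧ M(t) < 0 ∧ 0 < T(t)}` with `M(t) = κt^a/g_W + Σ q_it^a/P_i`, `T(t) = γt^c/g_W + Σ s_it^c/P_i` written out
(`dipWindow_ordConnected`).  Proof (the NOTE's): with `G = −g_W > 0` decreasing and `Σ q_i/P_i`, `Σ s_i/P_i` decreasing on `(0, t_W)`,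
`M < 0 ⟺ G·Σq_i/P_i < κ` is upward closed and `T > 0 ⟺ G·Σs_i/P_i > γ` is downward closed.

HONEST FRAMING: an exact free-standing structure lemma (input to the OPEN target T3 «dips inside one window»); NOT P6 / the floor law /
`OneRowZeroChange k`; no stub of LINE (A) is touched (A40 unchanged, sorries 4 → 4); `MatrixDescartes` OPEN; `VP ≠ VNP` is NOT proved
and nothing here bears on it.
-/

set_option linter.dupNamespace false

namespace Summit.ValiantsHypothesis.ValiantsHypothesis.Theorems.LacunarySymmetroidMatrixDescartes

namespace ZeroChange

open Polynomial Finset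

/-- A zero-change row (`p, s > 0 ≤ q`) is positive on `(0, ∞)`. -/
theorem eval_row_pos {a c : ℕ} {p q s t : ℝ} (hp : 0 < p) (hq : 0 ≤ q) (hs : 0 < s) (ht : 0 < t) :
    0 < (row a c p q s).eval t := by
  rw [show (row a c p q s).eval t = p + q * t ^ a + s * t ^ c by simp [row]]
  positivity

/-- A row with nonnegative upper coefficients is monotone on `(0, ∞)`: `t ≤ t'` ⇒ `g(t) ≤ g(t')`. -/
theorem eval_row_mono {a c : ℕ} (a₀ : ℝ) {a₁ a₂ : ℝ} (h1 : 0 ≤ a₁) (h2 : 0 ≤ a₂) {t t' : ℝ} (ht : 0 ≤ t) (htt : t ≤ t') :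
    (row a c a₀ a₁ a₂).eval t ≤ (row a c a₀ a₁ a₂).eval t' := by
  rw [show (row a c a₀ a₁ a₂).eval t = a₀ + a₁ * t ^ a + a₂ * t ^ c by simp [row],
    show (row a c a₀ a₁ a₂).eval t' = a₀ + a₁ * t' ^ a + a₂ * t' ^ c by simp [row]]
  have h3 : t ^ a ≤ t' ^ a := pow_le_pow_left₀ ht htt a
  have h4 : t ^ c ≤ t' ^ c := pow_le_pow_left₀ ht htt c
  nlinarith [mul_le_mul_of_nonneg_left h3 h1, mul_le_mul_of_nonneg_left h4 h2]

/-- **`r = 1` STRUCTURE LEMMA (NOTE §56.8 (3))**: for one W row `(−α, κ, γ)` (`γ > 0 ≤ κ`; `α` arbitrary — the window is cut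
out by `g_W(t) < 0`) and zero-change rows `(p_i, q_i, s_i)`
(`p_i, s_i > 0 ≤ q_i`), the dip window left of the W root — `{t > 0 ∣ g_W(t) < 0, M(t) < 0, T(t) > 0}` with the middle and top
Pick sums written out — is order-connected (ONE interval). -/
theorem dipWindow_ordConnected (a c : ℕ) (α κ γ : ℝ) (hκ : 0 ≤ κ) (hγ : 0 < γ) {k : ℕ} (p q s : Fin k → ℝ)
    (h : ∀ i, 0 < p i ∧ 0 ≤ q i ∧ 0 < s i) :
    Set.OrdConnected {t : ℝ | 0 < t ∧ (row a c (-α) κ γ).eval t < 0 ∧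
      κ * t ^ a / (row a c (-α) κ γ).eval t + ∑ i, q i * t ^ a / (row a c (p i) (q i) (s i)).eval t < 0 ∧
      0 < γ * t ^ c / (row a c (-α) κ γ).eval t + ∑ i, s i * t ^ c / (row a c (p i) (q i) (s i)).eval t} := by
  -- abbreviations
  set gW : ℝ → ℝ := fun t => (row a c (-α) κ γ).eval t with hgW
  set P : Fin k → ℝ → ℝ := fun i t => (row a c (p i) (q i) (s i)).eval t with hP
  have hPpos : ∀ i t, 0 < t → 0 < P i t := fun i t ht => eval_row_pos (h i).1 (h i).2.1 (h i).2.2 ht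
  have hPmono : ∀ i t t', 0 < t → t ≤ t' → P i t ≤ P i t' :=
    fun i t t' ht htt => eval_row_mono (p i) (h i).2.1 (h i).2.2.le ht.le htt
  have hgWmono : ∀ t t', 0 < t → t ≤ t' → gW t ≤ gW t' := fun t t' ht htt => eval_row_mono (-α) hκ hγ.le ht.le htt
  -- the two monotone quantities: Q(t) = Σ q_i/P_i and S(t) = Σ s_i/P_i decrease, G = −g_W decreases
  have hQmono : ∀ t t', 0 < t → t ≤ t' → ∑ i, q i / P i t' ≤ ∑ i, q i / P i t := by
    intro t t' ht htt
    exact sum_le_sum fun i _ => div_le_div_of_nonneg_left (h i).2.1 (hPpos i t ht) (hPmono i t t' ht htt)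
  have hSmono : ∀ t t', 0 < t → t ≤ t' → ∑ i, s i / P i t' ≤ ∑ i, s i / P i t := by
    intro t t' ht htt
    exact sum_le_sum fun i _ => div_le_div_of_nonneg_left (h i).2.2.le (hPpos i t ht) (hPmono i t t' ht htt)
  have hQnn : ∀ t, 0 < t → 0 ≤ ∑ i, q i / P i t := fun t ht => sum_nonneg fun i _ => div_nonneg (h i).2.1 (hPpos i t ht).le
  have hSnn : ∀ t, 0 < t → 0 ≤ ∑ i, s i / P i t := fun t ht => sum_nonneg fun i _ => div_nonneg (h i).2.2.le (hPpos i t ht).le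
  -- rewriting M and T:  M = t^a (κ/g_W + Q),  T = t^c (γ/g_W + S)
  have hM : ∀ t, κ * t ^ a / gW t + ∑ i, q i * t ^ a / P i t = t ^ a * (κ / gW t + ∑ i, q i / P i t) := by
    intro t; rw [mul_add, mul_sum]; congr 1; · ring
    exact sum_congr rfl fun i _ => by ring
  have hT : ∀ t, γ * t ^ c / gW t + ∑ i, s i * t ^ c / P i t = t ^ c * (γ / gW t + ∑ i, s i / P i t) := by
    intro t; rw [mul_add, mul_sum]; congr 1; · ring
    exact sum_congr rfl fun i _ => by ring
  -- M < 0  ⟺  (−g_W)·Q < κ ;  T > 0  ⟺  (−g_W)·S > γ   (for t > 0, g_W(t) < 0)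
  have hMiff : ∀ t, 0 < t → gW t < 0 →
      (κ * t ^ a / gW t + ∑ i, q i * t ^ a / P i t < 0 ↔ (-gW t) * ∑ i, q i / P i t < κ) := by
    intro t ht hg
    rw [hM t]
    have hta : 0 < t ^ a := pow_pos ht a
    rw [mul_neg_iff, or_iff_left (fun hh => absurd hta (not_lt.2 hh.1.le)), and_iff_right hta]
    have hG : 0 < -gW t := by linarith
    constructor
    · intro hlt
      have : κ / gW t = -(κ / (-gW t)) := by rw [div_neg, neg_neg]
      rw [this] at hlt
      have h2 : ∑ i, q i / P i t < κ / (-gW t) := by linarith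
      rwa [lt_div_iff₀ hG, mul_comm] at h2
    · intro hlt
      have h2 : ∑ i, q i / P i t < κ / (-gW t) := by rw [lt_div_iff₀ hG, mul_comm]; exact hlt
      have : κ / gW t = -(κ / (-gW t)) := by rw [div_neg, neg_neg]
      rw [this]; linarith
  have hTiff : ∀ t, 0 < t → gW t < 0 →
      (0 < γ * t ^ c / gW t + ∑ i, s i * t ^ c / P i t ↔ γ < (-gW t) * ∑ i, s i / P i t) := by
    intro t ht hg
    rw [hT t]
    have htc : 0 < t ^ c := pow_pos ht c
    rw [mul_pos_iff, or_iff_left (fun hh => absurd htc (not_lt.2 hh.1.le)), and_iff_right htc]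
    have hG : 0 < -gW t := by linarith
    constructor
    · intro hlt
      have : γ / gW t = -(γ / (-gW t)) := by rw [div_neg, neg_neg]
      rw [this] at hlt
      have h2 : γ / (-gW t) < ∑ i, s i / P i t := by linarith
      rwa [div_lt_iff₀ hG, mul_comm] at h2
    · intro hlt
      have h2 : γ / (-gW t) < ∑ i, s i / P i t := by rw [div_lt_iff₀ hG, mul_comm]; exact hlt
      have : γ / gW t = -(γ / (-gW t)) := by rw [div_neg, neg_neg]
      rw [this]; linarith
  -- order-connectedness
  refine ⟨fun x hx y hy t ht => ?_⟩
  obtain ⟨hx0, hxg, hxM, _⟩ := hx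
  obtain ⟨hy0, hyg, _, hyT⟩ := hy
  have ht0 : 0 < t := hx0.trans_le ht.1
  have htg : gW t < 0 := lt_of_le_of_lt (hgWmono t y ht0 ht.2) hyg
  refine ⟨ht0, htg, ?_, ?_⟩
  · -- M < 0 is upward closed from x
    rw [hMiff t ht0 htg]
    have h1 := (hMiff x hx0 hxg).1 hxM
    have hGt : -gW t ≤ -gW x := by linarith [hgWmono x t hx0 ht.1]
    have hGt0 : 0 ≤ -gW t := by linarith
    calc (-gW t) * ∑ i, q i / P i t ≤ (-gW x) * ∑ i, q i / P i x :=
          mul_le_mul hGt (hQmono x t hx0 ht.1) (hQnn t ht0) (by linarith)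
      _ < κ := h1
  · -- T > 0 is downward closed from y
    rw [hTiff t ht0 htg]
    have h1 := (hTiff y hy0 hyg).1 hyT
    have hGy : -gW y ≤ -gW t := by linarith [hgWmono t y ht0 ht.2]
    have hGy0 : 0 ≤ -gW y := by linarith
    calc γ < (-gW y) * ∑ i, s i / P i y := h1
      _ ≤ (-gW t) * ∑ i, s i / P i t := mul_le_mul hGy (hSmono t y ht0 ht.2) (hSnn y hy0) (by linarith)

end ZeroChange

end Summit.ValiantsHypothesis.ValiantsHypothesis.Theorems.LacunarySymmetroidMatrixDescartes
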